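import Summits.Ventures.CertifiedManyBodySolver.Observables.StiffnessApexTransportThermalFromGround
import Summits.Ventures.CertifiedManyBodySolver.Observables.StiffnessApexTransport
import HarnessLib

/-!
# Ventures/CertifiedManyBodySolver — Observables/StiffnessApexTransportThermalFromGroundHalfFilling.lean

HONEST FRAMING: one-sided certified CEILINGS on the THERMAL uniform flux stiffness at ONE inverse temperature, HALF FILLING, obtained from a
`T = 0` source's OWN f-sum word by the ground → thermal apex row plus the GROUND-STATE half-filling hinge `t′K₂ ≤ 0` AT THE SOURCE (in tree);
conditional BY NAME on the `T = 0` source row; entropy price `U_A·log 4/(4β(U_P − U_A))` (`2H_b(1/2) = log 4`); CONTROL / CALIBRATION class;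
a ceiling never speaks to presence; not a superconductivity verdict; no phase sentence. Zero compute, no definition, no claim node, no `sorry`.

Cell `pub/hubbard-downfold` (D-0096 (2) «T > 0» leg; D-0150 L-DF2), seat `hubbard-downfold-unc-2` (`prover-hubbard-downfold-unc-2-g18-0`); the
half-filling companion of `StiffnessApexTransportThermalFromGround` (target-slot / corner objectives, any density). THE POINT: at `n = 1` a torus-limit
GROUND state `ω_A` at `(t′_A, U_A)` has `t′_A·K₂(ω_A) ≤ 0` (`IsTorusLimitOf.tPrime_mul_diagHopEnergy_nonpos_of_groundState_halfFilling`), so its OWN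
f-sum word (objective `−X₀(t′_A)`, i.e. a floor on `e_{Φ(1,2t′_A,0)}(ω_A)`) is already a floor on the TARGET's objective `e_{Φ(1,2t′_P,0)}(ω_A)` when `A` lies
on `P`'s apex segment (`IsTorusLimitOf.meanEnergy_oneBody_anti_hopping_of_groundState_halfFilling`; `2t′_A − 2t′_P = c·t′_A`, `c ≥ 0`) — the hinge is
used at the SOURCE (a ground state), never at the thermal target. Hence every `T = 0` own-word stiffness node of record at `n = 1` is a THERMAL word at
every temperature along its apex curve `(t′_A U/(2U − U_A), U)`, `U > U_A`, and every own-word station family is a thermal word on its apex shadow: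

* §1 POINT: own floor / own f-sum ROW (`SquareTTPrimeCorrOrbitLowerRow t′_A U_A 1 u r univ Λ₇ (−X₀(t′_A))`, the node shape) / own orbit-mean sentence
  ⇒ `ObsThermalStiffnessSeqCeilingAtBeta t′_P U_P 1 β c`, `c ≥ −r + U_A·(2H_b(1/2)/β)/(U_P − U_A)/4`;
* §2 APEX CURVE of one corner word: `ObsThermalStiffnessSeqCeilingAtBeta (t′_A U/(2U − U_A)) U 1 β c` for every `U > U_A`;
* §3 STATION FAMILY (own objectives `−X₀(s)`, `s ∈ [a, b]`, at `U_A`) ⇒ the thermal leaf at every target whose apex source `t′_P(2 − U_A/U_P)` lies in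
  `[a, b]`, and the SLAB form `[p, q] × [U_lo, U_max]` (`U_A < U_lo`, family on `[p(2 − U_A/U_max), q]`) with ONE constant priced at `U_lo`.

NOT here: thermal SOURCES (the thermal hinge is not in the tree); corner-objective shadows `t′_P > σ` (they need the hinge at the thermal TARGET);
`U_P = U_A`; any `T_c` sentence.

References: T. Koma, H. Tasaki, J. Stat. Phys. 76 (1994) 745, §1 [KomaTasaki1994]; D. Ruelle, *Statistical Mechanics* (1969) §2.5 [Ruelle1969];
D. J. Scalapino, S. R. White, S.-C. Zhang, PRB 47 (1993) 7995, §II [ScalapinoWhiteZhang1993]; T. Hazra, N. Verma, M. Randeria, PRX 9 (2019) 031049,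
eqs. (2)–(4) [HazraVermaRanderia2019].
-/

noncomputable section

namespace Summit.Ventures.CertifiedManyBodySolver.Observables

open Filter Topology Matrix Finset
open Literature.MathematicalPhysics.QuantumLattice
open Literature.MathematicalPhysics.QuantumLattice.InfVolFermionState
open Literature.MathematicalPhysics.QuantumLattice.ThermodynamicLimit
open Literature.MathematicalPhysics.QuantumFieldTheory
open Literature.MathematicalPhysics.StatisticalMechanics
open Literature.MathematicalPhysics.StatisticalMechanics.KosterlitzThouless
open Literature.Probability.LatticeModels
open scoped ComplexConjugate ComplexOrder

/-! ## §1 Point transport at half filling from the source's OWN word -/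

section Point

variable {t'A UA t'P UP β : ℝ}

/-- **The doubled hoppings of source and target differ by a non-negative multiple of `t′_A`** on the apex segment (`0 ≤ U_A < U_P`,
`U_P t′_A = (2U_P − U_A) t′_P`): `2t′_A − 2t′_P = [2(U_P − U_A)/(2U_P − U_A)]·t′_A`. [folklore] -/
theorem apexSegment_twice_sub_twice_eq (hUA : 0 ≤ UA) (hU : UA < UP) (hapex : UP * t'A = (2 * UP - UA) * t'P) :
    2 * t'A - 2 * t'P = 2 * (UP - UA) / (2 * UP - UA) * t'A := by
  have h2 : 0 < 2 * UP - UA := by linarith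
  have ht'P : t'P = UP * t'A / (2 * UP - UA) := by rw [eq_div_iff h2.ne', hapex]; ring
  rw [ht'P]
  field_simp
  ring

/-- **HALF FILLING: the source's OWN `T = 0` f-sum floor is a THERMAL stiffness ceiling at the target.** `0 ≤ U_A < U_P`, `0 < β`,
`U_P t′_A = (2U_P − U_A) t′_P`; if `ℓ ≤ e_{Φ(1,2t′_A,0)}(ω_A)` for every torus limit `ω_A` of unit `(rectN 1 L, S^z = 0)`-sector GROUND states of
`hubbardTorusTT' L 1 t′_A U_A` (the source's own f-sum word, either sign of `t′`), then `ObsThermalStiffnessSeqCeilingAtBeta t′_P U_P 1 β c` for every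
`c ≥ −ℓ/4 + U_A·(2H_b(1/2)/β)/(U_P − U_A)/4` (ground-state hinge at the source, then `…_of_groundApexSource_floor`).
[cite: KomaTasaki1994, §1] [cite: Ruelle1969, §2.5] [cite: HazraVermaRanderia2019, eq. (4)] -/
theorem ObsThermalStiffnessSeqCeilingAtBeta_halfFilling_of_groundApexSource_ownFloor (hβ : 0 < β) (hUA : 0 ≤ UA) (hU : UA < UP)
    (hapex : UP * t'A = (2 * UP - UA) * t'P) {ℓ : ℝ}
    (hℓ : ∀ (ωA : InfVolFermionState 2) (LsA : ℕ → ℕ) (ψA : ∀ L, Fock (Orb (FermionTorus 2 L))),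
      Tendsto LsA atTop atTop →
      (∀ j, IsGroundStateInSector (hubbardTorusTT' (LsA j) 1 t'A UA) (rectN 1 (LsA j)) 0 (ψA (LsA j))) →
      (∀ j, star (ψA (LsA j)) ⬝ᵥ ψA (LsA j) = 1) → ωA.IsTorusLimitOf ψA LsA →
      ℓ ≤ ωA.meanEnergy (hubbardTTPrimeFermionInteraction 1 (2 * t'A) 0) 1)
    (c : ℚ) (hc : -ℓ / 4 + UA * (2 * Real.binEntropy ((1 : ℝ) / 2) / β) / (UP - UA) / 4 ≤ ((c : ℚ) : ℝ)) :
    ObsThermalStiffnessSeqCeilingAtBeta t'P UP 1 β c := by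
  have h2 : 0 < 2 * UP - UA := by linarith
  have hcoef : 0 ≤ 2 * (UP - UA) / (2 * UP - UA) := div_nonneg (by linarith) h2.le
  refine ObsThermalStiffnessSeqCeilingAtBeta_of_groundApexSource_floor (n := 1) zero_le_one one_lt_two hβ hUA hU hapex (ℓ := ℓ)
    (fun ω Ls ψ hLs hψ h1 hω => ?_) c hc
  exact (hℓ ω Ls ψ hLs hψ h1 hω).trans
    (IsTorusLimitOf.meanEnergy_oneBody_anti_hopping_of_groundState_halfFilling 1 t'A hUA hω hLs hψ h1 hcoef
      (apexSegment_twice_sub_twice_eq hUA hU hapex))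

/-- **From the source's own f-sum ROW (the claim-node shape of record)**: `SquareTTPrimeCorrOrbitLowerRow t′_A U_A 1 u r univ Λ₇ (−X₀(t′_A))` (any `U`-slot
`Uo`) with its cap `e(1,t′_A,U_A,1) ≤ u` certified ⇒ `ObsThermalStiffnessSeqCeilingAtBeta t′_P U_P 1 β c` for every `β > 0` and every
`c ≥ −r + U_A·(2H_b(1/2)/β)/(U_P − U_A)/4`. [cite: KomaTasaki1994, §1] [cite: ScalapinoWhiteZhang1993, §II] -/
theorem ObsThermalStiffnessSeqCeilingAtBeta_halfFilling_of_groundApexSource_fsumRow (Uo : ℝ) (hβ : 0 < β) (hUA : 0 ≤ UA)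
    (hU : UA < UP) (hapex : UP * t'A = (2 * UP - UA) * t'P) {u r : ℚ}
    (hrow : SquareTTPrimeCorrOrbitLowerRow t'A UA 1 u r Finset.univ (box 2 7) (-oddMomentObsTT t'A Uo 0))
    (hu : energyDensityTT' 1 t'A UA 1 ≤ ((u : ℚ) : ℝ)) (c : ℚ)
    (hc : -((r : ℚ) : ℝ) + UA * (2 * Real.binEntropy ((1 : ℝ) / 2) / β) / (UP - UA) / 4 ≤ ((c : ℚ) : ℝ)) :
    ObsThermalStiffnessSeqCeilingAtBeta t'P UP 1 β c := by
  refine ObsThermalStiffnessSeqCeilingAtBeta_halfFilling_of_groundApexSource_ownFloor hβ hUA hU hapex (ℓ := 4 * ((r : ℚ) : ℝ))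
    (fun ω Ls ψ hLs hψ h1 hω => ?_) c (by linarith)
  have h := hrow ω Ls ψ hLs hψ h1 hω hu
  rw [orbitMean_re_expect_neg_oddMomentTT_lam_zero hω.isTranslationInvariant] at h
  linarith

/-- **From the source's own orbit-mean SENTENCE** (a discharged own-word node: `F ≤ |D₄|⁻¹ Σ_γ Re ω_γ(−X₀(t′_A))` on the ground-state class at
`(t′_A, U_A, 1)`) ⇒ `ObsThermalStiffnessSeqCeilingAtBeta t′_P U_P 1 β c`, `c ≥ −F + U_A·(2H_b(1/2)/β)/(U_P − U_A)/4`. [cite: KomaTasaki1994, §1] [cite: ScalapinoWhiteZhang1993, §II] -/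
theorem ObsThermalStiffnessSeqCeilingAtBeta_halfFilling_of_groundApexSource_ownOrbitLower (Uo : ℝ) (hβ : 0 < β) (hUA : 0 ≤ UA)
    (hU : UA < UP) (hapex : UP * t'A = (2 * UP - UA) * t'P) {F : ℝ}
    (horb : ∀ (ω : InfVolFermionState 2) (Ls : ℕ → ℕ) (ψ : ∀ L, Fock (Orb (FermionTorus 2 L))),
      Tendsto Ls atTop atTop →
      (∀ j, IsGroundStateInSector (hubbardTorusTT' (Ls j) 1 t'A UA) (rectN 1 (Ls j)) 0 (ψ (Ls j))) →
      (∀ j, star (ψ (Ls j)) ⬝ᵥ ψ (Ls j) = 1) → ω.IsTorusLimitOf ψ Ls →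
      F ≤ ((Finset.univ : Finset (DihedralGroup 4)).card : ℝ)⁻¹ * ∑ g ∈ (Finset.univ : Finset (DihedralGroup 4)),
        (ω.expect (d4ShiftSet g 0 (box 2 7)) (fermionEmbed (PolySite.d4Emb g 0 (box 2 7)) (-oddMomentObsTT t'A Uo 0))).re)
    (c : ℚ) (hc : -F + UA * (2 * Real.binEntropy ((1 : ℝ) / 2) / β) / (UP - UA) / 4 ≤ ((c : ℚ) : ℝ)) :
    ObsThermalStiffnessSeqCeilingAtBeta t'P UP 1 β c := by
  refine ObsThermalStiffnessSeqCeilingAtBeta_halfFilling_of_groundApexSource_ownFloor hβ hUA hU hapex (ℓ := 4 * F)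
    (fun ω Ls ψ hLs hψ h1 hω => ?_) c (by linarith)
  have h := horb ω Ls ψ hLs hψ h1 hω
  rw [orbitMean_re_expect_neg_oddMomentTT_lam_zero hω.isTranslationInvariant] at h
  linarith

end Point

/-! ## §2 One corner word ⇒ the thermal leaf along its whole apex curve -/

section Curve

variable {t'A UA β : ℝ}

/-- **ONE `T = 0` own-word row covers its apex curve THERMALLY.** A certified f-sum orbit row `r` at `(t′_A, U_A, 1)` (`U_A ≥ 0`, cap `u` certified)
gives, for every `U > U_A` and every `β > 0`, `ObsThermalStiffnessSeqCeilingAtBeta (t′_A·U/(2U − U_A)) U 1 β c` for every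
`c ≥ −r + U_A·(2H_b(1/2)/β)/(U − U_A)/4` — the `T = 0` corner word plus the entropy price holds at every temperature along the curve
`t′(U) = t′_A U/(2U − U_A)` (example, the «La214-E» station `(8, 1, −3/10)`: the curve passes `(10, −1/4)`, `(12, −9/40)`, `(74/5, −37/180)`).
[cite: KomaTasaki1994, §1] [cite: ScalapinoWhiteZhang1993, §II] -/
theorem ObsThermalStiffnessSeqCeilingAtBeta_halfFilling_on_apexCurve_of_fsumRow (Uo : ℝ) (hβ : 0 < β) (hUA : 0 ≤ UA) {u r : ℚ}
    (hrow : SquareTTPrimeCorrOrbitLowerRow t'A UA 1 u r Finset.univ (box 2 7) (-oddMomentObsTT t'A Uo 0))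
    (hu : energyDensityTT' 1 t'A UA 1 ≤ ((u : ℚ) : ℝ)) {U : ℝ} (hU : UA < U) (c : ℚ)
    (hc : -((r : ℚ) : ℝ) + UA * (2 * Real.binEntropy ((1 : ℝ) / 2) / β) / (U - UA) / 4 ≤ ((c : ℚ) : ℝ)) :
    ObsThermalStiffnessSeqCeilingAtBeta (t'A * U / (2 * U - UA)) U 1 β c := by
  have h2 : 2 * U - UA ≠ 0 := ne_of_gt (by linarith)
  refine ObsThermalStiffnessSeqCeilingAtBeta_halfFilling_of_groundApexSource_fsumRow Uo hβ hUA hU ?_ hrow hu c hc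
  have e : (2 * U - UA) * (t'A * U / (2 * U - UA)) = t'A * U := by field_simp
  rw [e, mul_comm]

end Curve

/-! ## §3 A station family of own words ⇒ the thermal leaf on its apex shadow -/

section Station

variable {UA a b β : ℝ}

/-- **The thermal leaf at a point from an own-word orbit-lower FAMILY on a source segment at ONE station, half filling.** Station `U_A ≥ 0`; for
every `s ∈ [a, b]` the sentence `val s ≤ |D₄|⁻¹ Σ_γ Re ω_γ(−X₀(s))` on the ground-state class at `(s, U_A, 1)` (any `U`-slot `Uo`); a target
`(t′_P, U_P)` with `U_P > U_A` whose apex source `t′_P(2U_P − U_A)/U_P` lies in `[a, b]`; then `ObsThermalStiffnessSeqCeilingAtBeta t′_P U_P 1 β c` for every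
`β > 0` and every `c` with `−val s + U_A·(2H_b(1/2)/β)/(U_P − U_A)/4 ≤ c` at that source. [cite: KomaTasaki1994, §1] [cite: ScalapinoWhiteZhang1993, §II] -/
theorem ObsThermalStiffnessSeqCeilingAtBeta_halfFilling_of_forall_groundApexStation_orbitLower (Uo : ℝ) (hβ : 0 < β) (hUA : 0 ≤ UA)
    (val : ℝ → ℝ)
    (h : ∀ s ∈ Set.Icc a b, ∀ (ω : InfVolFermionState 2) (Ls : ℕ → ℕ) (ψ : ∀ L, Fock (Orb (FermionTorus 2 L))),
      Tendsto Ls atTop atTop →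
      (∀ j, IsGroundStateInSector (hubbardTorusTT' (Ls j) 1 s UA) (rectN 1 (Ls j)) 0 (ψ (Ls j))) →
      (∀ j, star (ψ (Ls j)) ⬝ᵥ ψ (Ls j) = 1) → ω.IsTorusLimitOf ψ Ls →
      val s ≤ ((Finset.univ : Finset (DihedralGroup 4)).card : ℝ)⁻¹ * ∑ g ∈ (Finset.univ : Finset (DihedralGroup 4)),
        (ω.expect (d4ShiftSet g 0 (box 2 7)) (fermionEmbed (PolySite.d4Emb g 0 (box 2 7)) (-oddMomentObsTT s Uo 0))).re)
    {t'P UP : ℝ} (hU : UA < UP) (hs : t'P * (2 * UP - UA) / UP ∈ Set.Icc a b) (c : ℚ)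
    (hc : -val (t'P * (2 * UP - UA) / UP) + UA * (2 * Real.binEntropy ((1 : ℝ) / 2) / β) / (UP - UA) / 4 ≤ ((c : ℚ) : ℝ)) :
    ObsThermalStiffnessSeqCeilingAtBeta t'P UP 1 β c := by
  have hUP : 0 < UP := hUA.trans_lt hU
  have hapex : UP * (t'P * (2 * UP - UA) / UP) = (2 * UP - UA) * t'P := by
    field_simp
  exact ObsThermalStiffnessSeqCeilingAtBeta_halfFilling_of_groundApexSource_ownOrbitLower Uo hβ hUA hU hapex
    (h _ hs) c hc

/-- **SLAB FORM.** Station `0 < U_A < U_lo`, slab heights `[U_lo, U_max]`, `q ≤ 0`, an own-word family on the source segment `[p(2 − U_A/U_max), q]` at `U_A` with a uniform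
value bound `−val s ≤ v`, and ONE constant `c ≥ v + U_A·(2H_b(1/2)/β)/(U_lo − U_A)/4` ⇒ `ObsThermalStiffnessSeqCeilingAtBeta tp U 1 β c` for every
`(tp, U) ∈ [p, q] × [U_lo, U_max]` (every such target's apex source lies in the segment, `apexSource_mem_Icc_of_slab`; the price is largest at `U_lo`).
[cite: KomaTasaki1994, §1] [cite: ScalapinoWhiteZhang1993, §II] -/
theorem ObsThermalStiffnessSeqCeilingAtBeta_halfFilling_on_slab_of_forall_groundApexStation_orbitLower (Uo : ℝ) (hβ : 0 < β)
    {Ulo Umax p q : ℝ} (hUA : 0 < UA) (hlo : UA < Ulo) (hq : q ≤ 0) (val : ℝ → ℝ) (v : ℝ)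
    (h : ∀ s ∈ Set.Icc (p * (2 - UA / Umax)) q, ∀ (ω : InfVolFermionState 2) (Ls : ℕ → ℕ) (ψ : ∀ L, Fock (Orb (FermionTorus 2 L))),
      Tendsto Ls atTop atTop →
      (∀ j, IsGroundStateInSector (hubbardTorusTT' (Ls j) 1 s UA) (rectN 1 (Ls j)) 0 (ψ (Ls j))) →
      (∀ j, star (ψ (Ls j)) ⬝ᵥ ψ (Ls j) = 1) → ω.IsTorusLimitOf ψ Ls →
      val s ≤ ((Finset.univ : Finset (DihedralGroup 4)).card : ℝ)⁻¹ * ∑ g ∈ (Finset.univ : Finset (DihedralGroup 4)),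
        (ω.expect (d4ShiftSet g 0 (box 2 7)) (fermionEmbed (PolySite.d4Emb g 0 (box 2 7)) (-oddMomentObsTT s Uo 0))).re)
    (hv : ∀ s ∈ Set.Icc (p * (2 - UA / Umax)) q, -val s ≤ v) (c : ℚ)
    (hc : v + UA * (2 * Real.binEntropy ((1 : ℝ) / 2) / β) / (Ulo - UA) / 4 ≤ ((c : ℚ) : ℝ)) :
    ∀ tp ∈ Set.Icc p q, ∀ U ∈ Set.Icc Ulo Umax, ObsThermalStiffnessSeqCeilingAtBeta tp U 1 β c := by
  intro tp htp U hU
  have hUAU : UA < U := hlo.trans_le hU.1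
  have hs := apexSource_mem_Icc_of_slab hUA hUAU.le hU.2 hq htp
  have hent : 0 ≤ 2 * Real.binEntropy ((1 : ℝ) / 2) / β :=
    div_nonneg (mul_nonneg (by norm_num) (Real.binEntropy_nonneg (by norm_num) (by norm_num))) hβ.le
  have hprice : UA * (2 * Real.binEntropy ((1 : ℝ) / 2) / β) / (U - UA) / 4 ≤
      UA * (2 * Real.binEntropy ((1 : ℝ) / 2) / β) / (Ulo - UA) / 4 :=
    div_le_div_of_nonneg_right
      (div_le_div_of_nonneg_left (mul_nonneg hUA.le hent) (sub_pos.2 hlo) (by linarith [hU.1])) (by norm_num)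
  refine ObsThermalStiffnessSeqCeilingAtBeta_halfFilling_of_forall_groundApexStation_orbitLower Uo hβ hUA.le val h hUAU hs c ?_
  have hvs := hv _ hs
  linarith

end Station

end Summit.Ventures.CertifiedManyBodySolver.Observables

end
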